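import Summits.AtomisticToContinuum.FouriersLaw.Theses.PhononMeanFreePath
import Literature.Barriers.AtomisticToContinuum.LowTemperatureWeakAnharmonicity
import Literature.MathematicalPhysics.KineticTheory.HarmonicChainNESS

/-!
# IncoherentChannel, harmonic corner (1/4): superposition for the constructed Langevin flow, kernel shift, reflection symmetry

Negative-side support for crux `PhononMeanFreePath.IncoherentChannel` (item stmt-AtomisticToContinuum-11811),
from the standing disprover's `Cruxes/IncoherentChannel/Disproof.lean` §5 (sorry-free, no definitions).
For the pinned HARMONIC chain `pinnedChain ω₂ 0 0 γ` the drift of the Langevin integral equation is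
linear, so by uniqueness of its continuous solutions the CONSTRUCTED pathwise flow is a superposition:
`harmonic_chainFlow_add/_smul`, `harmonic_chainFlow_zero_noise_linear` (`M_t : x ↦ Φ_t(x,0)` is a
linear map), `harmonic_solMap_eq_add`, `harmonic_transitionKernel_eq_map` (the transition kernel from
`x` is the kernel from rest translated by `M_t x`), `harmonic_integral_transitionKernel`. Also, for
EVERY chain of the family: `integral_gibbsMeasure_comp_neg` (reflection symmetry of the Gibbs
measure, change of variables `x ↦ -x` in the tilted Lebesgue measure) and
`integral_gibbsMeasure_eq_zero_of_odd`. Used by `KernelMoments`, `GibbsStein`, `HarmonicWick`.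
-/

noncomputable section

open MeasureTheory Filter Topology Set
open scoped NNReal
open Literature.MathematicalPhysics.KineticTheory.HeatConduction
open Literature.Probability.Process
open Literature.Barriers.AtomisticToContinuum.HeatConduction (hamiltonian_smul)
open Summit.AtomisticToContinuum.FouriersLaw.Theses.PhononMeanFreePath

namespace Summit.AtomisticToContinuum.FouriersLaw.Theorems.IncoherentChannel.Negative.HarmonicFlow

section HarmonicFlow

variable {ω₂ γ : ℝ} (hω : 0 < ω₂) (hγ : 0 ≤ γ) (n : ℕ)

/-- The harmonic drift is additive (linear force `Φ q`, linear friction). [folklore] -/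
theorem harmonic_drift_add (a b : PhaseSpace n) :
    (pinnedChain ω₂ 0 0 γ).drift n (a + b) =
      (pinnedChain ω₂ 0 0 γ).drift n a + (pinnedChain ω₂ 0 0 γ).drift n b := by
  have hγ1 : (pinnedChain ω₂ 0 0 γ).γ = γ := rfl
  ext i
  · simp [OscillatorChain.drift]
  · simp only [OscillatorChain.drift, Prod.snd_add, Prod.fst_add, Pi.add_apply, hγ1,
      pinnedChain_harmonic_partialQ_hamiltonian, Matrix.mulVec_add]
    ring

/-- The harmonic drift is homogeneous (every scalar). [folklore] -/
theorem harmonic_drift_smul (s : ℝ) (a : PhaseSpace n) :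
    (pinnedChain ω₂ 0 0 γ).drift n (s • a) = s • (pinnedChain ω₂ 0 0 γ).drift n a := by
  have hγ1 : (pinnedChain ω₂ 0 0 γ).γ = γ := rfl
  ext i
  · simp [OscillatorChain.drift]
  · simp only [OscillatorChain.drift, Prod.smul_snd, Prod.smul_fst, Pi.smul_apply, smul_eq_mul, hγ1,
      pinnedChain_harmonic_partialQ_hamiltonian, Matrix.mulVec_smul]
    ring

/-- Forcings scale (harmonic file copy of `forcing_smul`). [folklore] -/
theorem harmonic_forcing_smul (s : ℝ) (x : PhaseSpace n) (η : ℝ → Fin n → ℝ) (r : ℝ) :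
    OscillatorChain.forcing (s • x) (s • η) r = s • OscillatorChain.forcing x η r := by
  simp only [OscillatorChain.forcing, smul_add, Prod.smul_mk, smul_zero, Pi.smul_apply]

/-- Forcings add. [folklore] -/
theorem forcing_add (x₁ x₂ : PhaseSpace n) (η₁ η₂ : ℝ → Fin n → ℝ) (r : ℝ) :
    OscillatorChain.forcing (x₁ + x₂) (η₁ + η₂) r =
      OscillatorChain.forcing x₁ η₁ r + OscillatorChain.forcing x₂ η₂ r := by
  ext i
  · simp [OscillatorChain.forcing]
  · simp [OscillatorChain.forcing]; ring

include hω hγ in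
/-- **Superposition for the harmonic flow**: `Φ_t(x₁+x₂, η₁+η₂) = Φ_t(x₁,η₁) + Φ_t(x₂,η₂)` for
continuous noise paths (uniqueness of the Langevin integral equation with LINEAR drift). [folklore] -/
theorem harmonic_chainFlow_add (x₁ x₂ : PhaseSpace n) {η₁ η₂ : ℝ → Fin n → ℝ}
    (h₁ : Continuous η₁) (h₂ : Continuous η₂) (t : ℝ) :
    (pinnedChain ω₂ 0 0 γ).chainFlow n (x₁ + x₂) (η₁ + η₂) t =
      (pinnedChain ω₂ 0 0 γ).chainFlow n x₁ η₁ t + (pinnedChain ω₂ 0 0 γ).chainFlow n x₂ η₂ t := by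
  have h12 : Continuous (η₁ + η₂) := h₁.add h₂
  rcases le_or_gt t 0 with ht | ht
  · rw [pinnedChain_chainFlow_of_nonpos ω₂ 0 0 γ n (x₁ + x₂) h12 ht,
      pinnedChain_chainFlow_of_nonpos ω₂ 0 0 γ n x₁ h₁ ht, pinnedChain_chainFlow_of_nonpos ω₂ 0 0 γ n x₂ h₂ ht]
    ext i
    · simp
    · simp; ring
  · set z : ℝ → PhaseSpace n := fun r =>
      (pinnedChain ω₂ 0 0 γ).chainFlow n x₁ η₁ r + (pinnedChain ω₂ 0 0 γ).chainFlow n x₂ η₂ r with hz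
    have hc₁ := pinnedChain_continuous_chainFlow hω le_rfl le_rfl hγ n x₁ h₁
    have hc₂ := pinnedChain_continuous_chainFlow hω le_rfl le_rfl hγ n x₂ h₂
    have hzc : Continuous z := hc₁.add hc₂
    have hDc : Continuous ((pinnedChain ω₂ 0 0 γ).drift n) :=
      (pinnedChain_contDiff_drift ω₂ 0 0 γ n (n := 0)).continuous
    have hsol : Literature.Analysis.ODE.IsIntegralSolutionOn ((pinnedChain ω₂ 0 0 γ).drift n)
        (OscillatorChain.forcing (x₁ + x₂) (η₁ + η₂)) z t := by
      intro r hr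
      have e₁ := pinnedChain_isIntegralSolutionOn_chainFlow hω le_rfl le_rfl hγ n x₁ h₁ t r hr
      have e₂ := pinnedChain_isIntegralSolutionOn_chainFlow hω le_rfl le_rfl hγ n x₂ h₂ t r hr
      have hI₁ : IntervalIntegrable (fun τ => (pinnedChain ω₂ 0 0 γ).drift n
          ((pinnedChain ω₂ 0 0 γ).chainFlow n x₁ η₁ τ)) volume 0 r :=
        (hDc.comp hc₁).intervalIntegrable _ _
      have hI₂ : IntervalIntegrable (fun τ => (pinnedChain ω₂ 0 0 γ).drift n
          ((pinnedChain ω₂ 0 0 γ).chainFlow n x₂ η₂ τ)) volume 0 r :=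
        (hDc.comp hc₂).intervalIntegrable _ _
      simp only [hz]
      rw [e₁, e₂, forcing_add]
      simp_rw [harmonic_drift_add]
      rw [intervalIntegral.integral_add hI₁ hI₂]
      abel
    exact (pinnedChain_eqOn_chainFlow hω le_rfl le_rfl hγ n (x₁ + x₂) h12 hsol hzc ⟨ht.le, le_rfl⟩).symm

include hω hγ in
/-- Homogeneity of the harmonic flow for EVERY scalar (the case `s ≠ 0` is `chainFlow_smul` at
`lam = β = 0`; `s = 0` follows from superposition). [folklore] -/
theorem harmonic_chainFlow_smul (s : ℝ) (x : PhaseSpace n) {η : ℝ → Fin n → ℝ} (hη : Continuous η)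
    (t : ℝ) :
    (pinnedChain ω₂ 0 0 γ).chainFlow n (s • x) (s • η) t = s • (pinnedChain ω₂ 0 0 γ).chainFlow n x η t := by
  have hη' : Continuous (s • η) := hη.const_smul s
  rcases le_or_gt t 0 with ht | ht
  · rw [pinnedChain_chainFlow_of_nonpos ω₂ 0 0 γ n (s • x) hη' ht,
      pinnedChain_chainFlow_of_nonpos ω₂ 0 0 γ n x hη ht]
    simp only [smul_add, Prod.smul_mk, smul_zero, Pi.smul_apply]
  · set z : ℝ → PhaseSpace n := fun r => s • (pinnedChain ω₂ 0 0 γ).chainFlow n x η r with hz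
    have hzc : Continuous z := (pinnedChain_continuous_chainFlow hω le_rfl le_rfl hγ n x hη).const_smul s
    have hsol : Literature.Analysis.ODE.IsIntegralSolutionOn ((pinnedChain ω₂ 0 0 γ).drift n)
        (OscillatorChain.forcing (s • x) (s • η)) z t := by
      intro r hr
      have h' := pinnedChain_isIntegralSolutionOn_chainFlow hω le_rfl le_rfl hγ n x hη t r hr
      simp only [hz]
      rw [h', smul_add, harmonic_forcing_smul, ← intervalIntegral.integral_smul]
      congr 1
      congr 1
      funext τ
      exact (harmonic_drift_smul n s _).symm
    exact (pinnedChain_eqOn_chainFlow hω le_rfl le_rfl hγ n (s • x) hη' hsol hzc ⟨ht.le, le_rfl⟩).symm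

include hω hγ in
/-- **The deterministic harmonic flow is a linear map** `M_t : x ↦ Φ_t(x, 0)`. [folklore] -/
theorem harmonic_chainFlow_zero_noise_linear (t : ℝ) :
    ∃ M : PhaseSpace n →ₗ[ℝ] PhaseSpace n, ∀ x, (pinnedChain ω₂ 0 0 γ).chainFlow n x 0 t = M x := by
  refine ⟨{ toFun := fun x => (pinnedChain ω₂ 0 0 γ).chainFlow n x 0 t
            map_add' := fun x y => ?_
            map_smul' := fun s x => ?_ }, fun x => rfl⟩
  · have h := harmonic_chainFlow_add hω hγ n x y (η₁ := 0) (η₂ := 0) continuous_const continuous_const t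
    simpa using h
  · have h := harmonic_chainFlow_smul hω hγ n s x (η := 0) continuous_const t
    simp only [smul_zero] at h
    simpa using h

include hω hγ in
/-- Decomposition of the solution map: `Φ_t(x, w) = M_t x + Φ_t(0, w)` (deterministic linear response
plus the noise-driven part started at rest). [folklore] -/
theorem harmonic_solMap_eq_add (T_L T_R t : ℝ) (x : PhaseSpace n) (w : WienerPair) :
    (pinnedChain ω₂ 0 0 γ).solMap n T_L T_R t x w =
      (pinnedChain ω₂ 0 0 γ).chainFlow n x 0 t + (pinnedChain ω₂ 0 0 γ).solMap n T_L T_R t 0 w := by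
  unfold OscillatorChain.solMap
  have h := harmonic_chainFlow_add hω hγ n x 0 (η₁ := 0)
    (η₂ := chainNoise n (Real.sqrt (2 * (pinnedChain ω₂ 0 0 γ).γ * T_L))
      (Real.sqrt (2 * (pinnedChain ω₂ 0 0 γ).γ * T_R)) w) continuous_const (continuous_chainNoise _ _ w) t
  simpa using h

include hω hγ in
/-- **Kernel shift**: the harmonic transition kernel from `x` is the kernel from `0` translated by the
deterministic flow, `P_t(x, ·) = P_t(0, ·) ∘ (y ↦ M_t x + y)⁻¹`. [folklore] -/
theorem harmonic_transitionKernel_eq_map (T_L T_R : ℝ) (t : ℝ≥0) (x : PhaseSpace n) :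
    (pinnedChain ω₂ 0 0 γ).transitionKernel n T_L T_R t x =
      ((pinnedChain ω₂ 0 0 γ).transitionKernel n T_L T_R t 0).map
        (fun y => (pinnedChain ω₂ 0 0 γ).chainFlow n x 0 t + y) := by
  rw [pinnedChain_transitionKernel_apply hω le_rfl le_rfl hγ, pinnedChain_transitionKernel_apply hω le_rfl le_rfl hγ,
    Measure.map_map (measurable_const_add _)
      (pinnedChain_measurable_solMap_pairPath_right hω le_rfl le_rfl hγ n T_L T_R t 0)]
  congr 1
  funext ω
  simp only [Function.comp_apply]
  exact harmonic_solMap_eq_add hω hγ n T_L T_R t x (pairPath ω)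

include hω hγ in
/-- Integrals against the shifted kernel. [folklore] -/
theorem harmonic_integral_transitionKernel (T_L T_R : ℝ) (t : ℝ≥0) (x : PhaseSpace n)
    (f : PhaseSpace n → ℝ) :
    ∫ y, f y ∂((pinnedChain ω₂ 0 0 γ).transitionKernel n T_L T_R t x) =
      ∫ y, f ((pinnedChain ω₂ 0 0 γ).chainFlow n x 0 t + y)
        ∂((pinnedChain ω₂ 0 0 γ).transitionKernel n T_L T_R t 0) := by
  rw [harmonic_transitionKernel_eq_map hω hγ n]
  exact integral_map_equiv (MeasurableEquiv.addLeft ((pinnedChain ω₂ 0 0 γ).chainFlow n x 0 t)) f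

end HarmonicFlow

section Reflection

variable {ω₂ lam β γ : ℝ} (n : ℕ)

/-- **Reflection symmetry of every Gibbs measure of the family**: `∫ g dμ_T = ∫ g(-x) dμ_T(x)`
(the amplitude scaling with `s = -1`). [folklore] -/
theorem integral_gibbsMeasure_comp_neg (T : ℝ) (g : PhaseSpace n → ℝ) :
    ∫ y, g y ∂((pinnedChain ω₂ lam β γ).gibbsMeasure n T) =
      ∫ x, g (-x) ∂((pinnedChain ω₂ lam β γ).gibbsMeasure n T) := by
  set H := (pinnedChain ω₂ lam β γ).hamiltonian n with hHdef
  haveI : (volume : Measure (PhaseSpace n)).IsAddHaarMeasure :=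
    @Measure.prod.instIsAddHaarMeasure (Fin n → ℝ) _ _ _ (Fin n → ℝ) _ _ _ volume volume _ _ _ _ _ _
  have key : ∀ G : PhaseSpace n → ℝ, ∫ x, G ((-1 : ℝ) • x) = ∫ x, G x := by
    intro G
    rw [Measure.integral_comp_smul volume G (-1)]
    simp
  have hH : ∀ x : PhaseSpace n, -H ((-1 : ℝ) • x) / T = -H x / T := by
    intro x
    rw [hHdef, hamiltonian_smul]
    simp
  have hH' : ∀ x : PhaseSpace n, -H (-x) / T = -H x / T := fun x => by simpa using hH x
  simp only [OscillatorChain.gibbsMeasure_eq, integral_tilted]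
  rw [← hHdef, ← key (fun y => (Real.exp (-H y / T) / ∫ y, Real.exp (-H y / T)) • g y)]
  simp only [neg_one_smul, hH']

/-- Odd observables have vanishing Gibbs mean (no integrability needed). [folklore] -/
theorem integral_gibbsMeasure_eq_zero_of_odd (T : ℝ) {g : PhaseSpace n → ℝ} (hg : ∀ x, g (-x) = -g x) :
    ∫ y, g y ∂((pinnedChain ω₂ lam β γ).gibbsMeasure n T) = 0 := by
  have h := integral_gibbsMeasure_comp_neg (ω₂ := ω₂) (lam := lam) (β := β) (γ := γ) n T g
  simp_rw [hg, integral_neg] at h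
  linarith

end Reflection

end Summit.AtomisticToContinuum.FouriersLaw.Theorems.IncoherentChannel.Negative.HarmonicFlow
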